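/-
Copyright: the b2b-balaban T⁴-continuum CRUX team, row NE7b OWNER lineage `t4-ne7b-p1` (gen 141). Project licence.
-/
import Summits.QuantumFields.BalabanUV.T4Continuum.Spine.NE7b.SupWhitenedFourthMoment

/-!
# THE VARIANCE AND THE FOURTH CENTRED MOMENT OF A GENERIC LIPSCHITZ OBSERVABLE UNDER `N(0,AAᵀ)` IN WHITENED COORDINATES — the moment
# letters `m₂, m₄` for ANY observable (SCOPING (d13)(2): the M-letters of the order-4 pieces).  (464)∕(465) proved, for the gradient
# component `g_v(ξ) = U′(Aξ+ψ)[e_v]` (Lipschitz constant `κ₂√γ_op` in `ξ`), `Var ≤ κ₂²γ_op∕(1−λγ_op)` and `E(g_v − μ)⁴ ≤ 5κ₂⁴γ_op²∕(1−λγ_op)²`.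
# The SAME two Poincaré steps ((422) in the `ξ`-coordinates: `M = I`, floor `1`, secant letter `λγ_op`) run for ANY `ξ`-`C¹` observable `g`
# with `‖D_ξ g‖ ≤ L` and the integrability letters `e·g, e·g², e·g⁴ ∈ L¹(N(0,I))`:
#   `Var_ν̃(g) ≤ L²∕(1 − λγ_op)`,   `E_ν̃(g − μ)⁴ ≤ 5L⁴∕(1 − λγ_op)²`   (`μ` the tilted mean; uniform in `ψ` and the volume)
# — the letters the Hessian-entry observables `G_{xy} = U″(Aξ+ψ)[e_x,e_y]` (`L = κ₃√γ_op`) and the third-derivative-entry observables need in the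
# three-point pieces of `∂⁴W`, and the first half of the sixth-moment letter `M₆` (row NE7b, node U5c; (422) `tilted_poincare`, (458), (464)
# `whitened_secant`, `one_floor`, (456) `whitened_hasFDerivAt` BY NAME; [folklore] + [cite: BrascampLieb1976, Thm 4.1] through (422))

Cell `pub-balaban`, sub-cell `t4`, spine estimate NE7b (`T4WeightBudget.RelWeightBound`; the cell's OWN estimate — NOT PRINTED in
[Bałaban 1983–89], NOT PROVED).  Crux-route work under `Spine/NE7b/` by the row OWNER (`t4-ne7b-p1` gen 141, file (503)) under FREEZE
(0)'s crux-prover clause; NOTHING of Bałaban's is named as a Lean object, valued or asserted; no `T4Continuum/Support` leaf typed; no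
`def`, no notation; zero `sorry`.  Imports (BY NAME): the OWNER's (465) `…SupWhitenedFourthMoment` (for its imports: (464)
`whitened_secant`, `one_floor`, (422) `tilted_poincare`, (458) `whitened_exp_integrable`, `op_letter_nonneg`, (456) `whitened_hasFDerivAt`).

WHAT IS PROVED ([folklore]; generic `g` with `‖D_ξg‖ ≤ L`):
* §1 **`obs_variance_le`** (`Z⁻¹∫e g² − (Z⁻¹∫e g)² ≤ L²∕(1−λγ_op)`).
* §2 **`obs_fourth_moment_le`** (`Z⁻¹∫e(g − μ)⁴ ≤ 5L⁴∕(1−λγ_op)²`; `e·|g|³ ∈ L¹` from `|t|³ ≤ t² + t⁴` inline); §3 toy.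

HONEST (what this is NOT).  Moment letters for a generic observable; the Gibbs-format transfers, the sixth moment (`Var((g−μ)³)` by one more
Poincaré step + `(E(g−μ)³)² ≤ E(g−μ)²E(g−μ)⁴`) and the instantiations (Hessian entries; `M₆` of the gradient components with (423) extended
to `‖U′‖⁶`) are the next files; the three-point pieces and the cumulant FORM of `∂⁴W` are NOT typed.  Scalar skeleton ((A3), NC-NE7b-α
UNRULED); nothing of Bałaban's asserted.  BY-NAME EFFECT ON THE WALL: NONE.  NE7b NOT PRINTED ∕ NOT PROVED; spine PROVED 0∕9; rung (B)+1 —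
the programme's measures remain FINITE-torus statements; NOT the mass gap, NOT Clay.  HONEST DEPENDENCY: continuum YM on T⁴ ⇐ BetaPertH ∧
nine spine estimates (0∕9 proved); BetaPertH ⇐ (D1) ∧ (D4) ∧ CAP+tail; G-an2-4 gates asym, D1 and NE2∕3∕4.
-/

set_option autoImplicit false
set_option maxSynthPendingDepth 2

noncomputable section

namespace Summit.QuantumFields.BalabanUV.T4Continuum.NE7b.SupWhitenedObservableMoments

open MeasureTheory ProbabilityTheory Real Set Function Finset Matrix
open scoped BigOperators
open Literature.Probability.Distributions (matrixCLM)
open SupWhitenedPoincareLetters (whitened_secant one_floor)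
open SupWhitenedMomentLetters (op_letter_nonneg whitened_exp_integrable)
open SupWhitenedFirstOrderLetters (whitened_hasFDerivAt)
open SupTiltedPoincare (tilted_poincare)

variable {ι κ : Type} [Fintype ι] [DecidableEq ι] [Fintype κ] [DecidableEq κ]

variable {U : EuclideanSpace ℝ ι → ℝ} {U' : EuclideanSpace ℝ ι → EuclideanSpace ℝ ι →L[ℝ] ℝ} {A : Matrix ι κ ℝ} {γop κ₀ τ θ lam L : ℝ}
  {g : EuclideanSpace ℝ κ → ℝ} {g' : EuclideanSpace ℝ κ → EuclideanSpace ℝ κ →L[ℝ] ℝ}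

/-! ## §1. The variance of a generic Lipschitz observable -/

/-- **`Var_ν̃(g) ≤ L²∕(1 − λγ_op)`** for a `ξ`-`C¹` observable with `‖D_ξg‖ ≤ L` and `e·g, e·g² ∈ L¹(N(0,I))`, the tilted law
`ν̃ ∝ e^{−U(Aξ+ψ)}dN(0,I)(ξ)`; uniform in `ψ` and the volume. [folklore] -/
theorem obs_variance_le [Nonempty ι] (hΓop : (γop • (1 : Matrix ι ι ℝ) - A * Aᵀ).PosSemidef) (Y : Finset ι)
    (hUd : ∀ φ : EuclideanSpace ℝ ι, HasFDerivAt U (U' φ) φ) (hκ₀ : 0 ≤ κ₀) (hτ : 0 < τ) (hθ1 : θ < 1) (hκθ : 2 * κ₀ * (1 + τ) * γop ≤ θ)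
    (hstab : ∀ φ : EuclideanSpace ℝ ι, -(κ₀ * ∑ x ∈ Y, φ x ^ 2) ≤ U φ) (hlam : 0 ≤ lam)
    (hUsec : ∀ s : ℝ, 0 ≤ s → s ≤ 1 → ∀ a b : EuclideanSpace ℝ ι,
      U ((1 - s) • a + s • b) - lam / 2 * (s * (1 - s)) * ∑ i, (a i - b i) ^ 2 ≤ (1 - s) * U a + s * U b)
    (hρ : lam * γop < 1) (ψ : EuclideanSpace ℝ ι) (hgd : ∀ ξ : EuclideanSpace ℝ κ, HasFDerivAt g (g' ξ) ξ) (hg'c : Continuous g')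
    (hg'b : ∀ ξ : EuclideanSpace ℝ κ, ‖g' ξ‖ ≤ L)
    (k1 : Integrable (fun ξ : EuclideanSpace ℝ κ => exp (-U (matrixCLM A ξ + ψ)) * g ξ) (multivariateGaussian 0 (1 : Matrix κ κ ℝ)))
    (k2 : Integrable (fun ξ : EuclideanSpace ℝ κ => exp (-U (matrixCLM A ξ + ψ)) * g ξ ^ 2) (multivariateGaussian 0 (1 : Matrix κ κ ℝ))) :
    (∫ ξ : EuclideanSpace ℝ κ, exp (-U (matrixCLM A ξ + ψ)) ∂(multivariateGaussian 0 (1 : Matrix κ κ ℝ)))⁻¹ *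
          (∫ ξ : EuclideanSpace ℝ κ, exp (-U (matrixCLM A ξ + ψ)) * g ξ ^ 2 ∂(multivariateGaussian 0 (1 : Matrix κ κ ℝ))) -
        ((∫ ξ : EuclideanSpace ℝ κ, exp (-U (matrixCLM A ξ + ψ)) ∂(multivariateGaussian 0 (1 : Matrix κ κ ℝ)))⁻¹ *
          (∫ ξ : EuclideanSpace ℝ κ, exp (-U (matrixCLM A ξ + ψ)) * g ξ ∂(multivariateGaussian 0 (1 : Matrix κ κ ℝ)))) ^ 2 ≤
      L ^ 2 / (1 - lam * γop) := by
  have hUc : Continuous U := continuous_iff_continuousAt.2 fun φ => (hUd φ).continuousAt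
  have hγ := op_letter_nonneg hΓop
  have hI := whitened_exp_integrable hΓop Y hUc.measurable hκ₀ hτ hθ1 hκθ hstab ψ
  have hZ : 0 < ∫ ξ : EuclideanSpace ℝ κ, exp (-U (matrixCLM A ξ + ψ)) ∂(multivariateGaussian 0 (1 : Matrix κ κ ℝ)) := integral_exp_pos hI
  have hρ0 : 0 < 1 - lam * γop := sub_pos.2 hρ
  have hEc : Continuous fun ξ : EuclideanSpace ℝ κ => exp (-U (matrixCLM A ξ + ψ)) :=
    continuous_exp.comp ((hUc.comp ((matrixCLM A).continuous.add continuous_const)).neg)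
  have k3 : Integrable (fun ξ : EuclideanSpace ℝ κ => exp (-U (matrixCLM A ξ + ψ)) *
      ‖g' ξ‖ ^ 2) (multivariateGaussian 0 (1 : Matrix κ κ ℝ)) :=
    (hI.mul_const (L ^ 2)).mono' ((hEc.mul ((continuous_norm.comp hg'c).pow 2)).aestronglyMeasurable)
      (ae_of_all _ fun ξ => by
        rw [Real.norm_eq_abs, abs_of_nonneg (mul_nonneg (exp_pos _).le (sq_nonneg _))]
        exact mul_le_mul_of_nonneg_left (pow_le_pow_left₀ (norm_nonneg _) (hg'b ξ) 2) (exp_pos _).le)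
  -- (422) in the `ξ`-coordinates
  have hP := tilted_poincare (M := (1 : Matrix κ κ ℝ)) (m := 1) (lam := lam * γop) (U := fun η : EuclideanSpace ℝ κ => U (matrixCLM A η + ψ))
    (U' := fun η : EuclideanSpace ℝ κ => (U' (matrixCLM A η + ψ)).comp (matrixCLM A)) Matrix.PosDef.one one_floor (whitened_hasFDerivAt hUd A ψ)
    (by positivity) (fun s hs0 hs1 a b => whitened_secant hΓop hlam hUsec ψ s hs0 hs1 a b) hρ (0 : EuclideanSpace ℝ κ)
    (by simpa only [add_zero, inv_one] using hI) hgd hg'c (by simpa only [add_zero, inv_one] using k1) (by simpa only [add_zero, inv_one] using k2)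
    (by simpa only [add_zero, inv_one] using k3)
  simp only [add_zero, inv_one] at hP
  -- the right side: `Z⁻¹∫e‖g′‖² ≤ L²`
  have hR : (∫ ξ : EuclideanSpace ℝ κ, exp (-U (matrixCLM A ξ + ψ)) ∂(multivariateGaussian 0 (1 : Matrix κ κ ℝ)))⁻¹ *
      (∫ ξ : EuclideanSpace ℝ κ, exp (-U (matrixCLM A ξ + ψ)) * ‖g' ξ‖ ^ 2
        ∂(multivariateGaussian 0 (1 : Matrix κ κ ℝ))) ≤ L ^ 2 := by
    have h1 : (∫ ξ : EuclideanSpace ℝ κ, exp (-U (matrixCLM A ξ + ψ)) * ‖g' ξ‖ ^ 2 ∂(multivariateGaussian 0 (1 : Matrix κ κ ℝ))) ≤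
        ∫ ξ : EuclideanSpace ℝ κ, exp (-U (matrixCLM A ξ + ψ)) * L ^ 2 ∂(multivariateGaussian 0 (1 : Matrix κ κ ℝ)) :=
      integral_mono k3 (hI.mul_const _) fun ξ => mul_le_mul_of_nonneg_left (pow_le_pow_left₀ (norm_nonneg _) (hg'b ξ) 2) (exp_pos _).le
    rw [integral_mul_const] at h1
    calc _ ≤ (∫ ξ : EuclideanSpace ℝ κ, exp (-U (matrixCLM A ξ + ψ)) ∂(multivariateGaussian 0 (1 : Matrix κ κ ℝ)))⁻¹ *
          ((∫ ξ : EuclideanSpace ℝ κ, exp (-U (matrixCLM A ξ + ψ)) ∂(multivariateGaussian 0 (1 : Matrix κ κ ℝ))) * L ^ 2) :=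
          mul_le_mul_of_nonneg_left h1 (inv_nonneg.2 hZ.le)
      _ = L ^ 2 := by rw [← mul_assoc, inv_mul_cancel₀ hZ.ne', one_mul]
  calc _ ≤ (1 - lam * γop)⁻¹ * ((∫ ξ : EuclideanSpace ℝ κ, exp (-U (matrixCLM A ξ + ψ)) ∂(multivariateGaussian 0 (1 : Matrix κ κ ℝ)))⁻¹ *
        (∫ ξ : EuclideanSpace ℝ κ, exp (-U (matrixCLM A ξ + ψ)) * ‖g' ξ‖ ^ 2
          ∂(multivariateGaussian 0 (1 : Matrix κ κ ℝ)))) := hP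
    _ ≤ (1 - lam * γop)⁻¹ * (L ^ 2) := mul_le_mul_of_nonneg_left hR (inv_nonneg.2 hρ0.le)
    _ = L ^ 2 / (1 - lam * γop) := by rw [div_eq_inv_mul]

/-! ## §2. The fourth centred moment of a generic Lipschitz observable -/

/-- **`E_ν̃(g − μ)⁴ ≤ 5L⁴∕(1 − λγ_op)²`**: Poincaré once more on `(g − μ)²` (`‖D(g−μ)²‖² ≤ 4L²(g−μ)²`), `μ = Z⁻¹∫e g` the tilted mean;
`e·g, e·g², e·g⁴ ∈ L¹(N(0,I))`. [folklore] -/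
theorem obs_fourth_moment_le [Nonempty ι] (hΓop : (γop • (1 : Matrix ι ι ℝ) - A * Aᵀ).PosSemidef) (Y : Finset ι)
    (hUd : ∀ φ : EuclideanSpace ℝ ι, HasFDerivAt U (U' φ) φ) (hκ₀ : 0 ≤ κ₀) (hτ : 0 < τ) (hθ1 : θ < 1) (hκθ : 2 * κ₀ * (1 + τ) * γop ≤ θ)
    (hstab : ∀ φ : EuclideanSpace ℝ ι, -(κ₀ * ∑ x ∈ Y, φ x ^ 2) ≤ U φ) (hlam : 0 ≤ lam)
    (hUsec : ∀ s : ℝ, 0 ≤ s → s ≤ 1 → ∀ a b : EuclideanSpace ℝ ι,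
      U ((1 - s) • a + s • b) - lam / 2 * (s * (1 - s)) * ∑ i, (a i - b i) ^ 2 ≤ (1 - s) * U a + s * U b)
    (hρ : lam * γop < 1) (ψ : EuclideanSpace ℝ ι) (hgd : ∀ ξ : EuclideanSpace ℝ κ, HasFDerivAt g (g' ξ) ξ) (hg'c : Continuous g')
    (hg'b : ∀ ξ : EuclideanSpace ℝ κ, ‖g' ξ‖ ≤ L)
    (k1 : Integrable (fun ξ : EuclideanSpace ℝ κ => exp (-U (matrixCLM A ξ + ψ)) * g ξ) (multivariateGaussian 0 (1 : Matrix κ κ ℝ)))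
    (k2 : Integrable (fun ξ : EuclideanSpace ℝ κ => exp (-U (matrixCLM A ξ + ψ)) * g ξ ^ 2) (multivariateGaussian 0 (1 : Matrix κ κ ℝ)))
    (k4 : Integrable (fun ξ : EuclideanSpace ℝ κ => exp (-U (matrixCLM A ξ + ψ)) * g ξ ^ 4) (multivariateGaussian 0 (1 : Matrix κ κ ℝ))) :
    (∫ ξ : EuclideanSpace ℝ κ, exp (-U (matrixCLM A ξ + ψ)) ∂(multivariateGaussian 0 (1 : Matrix κ κ ℝ)))⁻¹ *
        (∫ ξ : EuclideanSpace ℝ κ, exp (-U (matrixCLM A ξ + ψ)) * (g ξ -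
          (∫ ξ : EuclideanSpace ℝ κ, exp (-U (matrixCLM A ξ + ψ)) ∂(multivariateGaussian 0 (1 : Matrix κ κ ℝ)))⁻¹ *
            (∫ ξ : EuclideanSpace ℝ κ, exp (-U (matrixCLM A ξ + ψ)) * g ξ ∂(multivariateGaussian 0 (1 : Matrix κ κ ℝ)))) ^ 4
          ∂(multivariateGaussian 0 (1 : Matrix κ κ ℝ))) ≤
      5 * L ^ 4 / (1 - lam * γop) ^ 2 := by
  have hUc : Continuous U := continuous_iff_continuousAt.2 fun φ => (hUd φ).continuousAt
  have hγ := op_letter_nonneg hΓop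
  have hI := whitened_exp_integrable hΓop Y hUc.measurable hκ₀ hτ hθ1 hκθ hstab ψ
  have hZ : 0 < ∫ ξ : EuclideanSpace ℝ κ, exp (-U (matrixCLM A ξ + ψ)) ∂(multivariateGaussian 0 (1 : Matrix κ κ ℝ)) := integral_exp_pos hI
  have hρ0 : 0 < 1 - lam * γop := sub_pos.2 hρ
  set μ : ℝ := (∫ ξ : EuclideanSpace ℝ κ, exp (-U (matrixCLM A ξ + ψ)) ∂(multivariateGaussian 0 (1 : Matrix κ κ ℝ)))⁻¹ *
      (∫ ξ : EuclideanSpace ℝ κ, exp (-U (matrixCLM A ξ + ψ)) * g ξ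
        ∂(multivariateGaussian 0 (1 : Matrix κ κ ℝ))) with hμ
  have hsh : Continuous fun ξ : EuclideanSpace ℝ κ => matrixCLM A ξ + ψ := (matrixCLM A).continuous.add continuous_const
  have hgc : Continuous g := continuous_iff_continuousAt.2 fun ξ => (hgd ξ).continuousAt
  have hEc : Continuous fun ξ : EuclideanSpace ℝ κ => exp (-U (matrixCLM A ξ + ψ)) := continuous_exp.comp ((hUc.comp hsh).neg)
  -- `e·|g|³` is integrable (`|t|³ ≤ t² + t⁴`)
  have k3 : Integrable (fun ξ : EuclideanSpace ℝ κ => exp (-U (matrixCLM A ξ + ψ)) * |g ξ| ^ 3) (multivariateGaussian 0 (1 : Matrix κ κ ℝ)) := by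
    have hm : Continuous fun ξ : EuclideanSpace ℝ κ => exp (-U (matrixCLM A ξ + ψ)) * |g ξ| ^ 3 := hEc.mul ((continuous_abs.comp hgc).pow 3)
    refine (k2.add k4).mono' hm.aestronglyMeasurable (ae_of_all _ fun ξ => ?_)
    rw [Real.norm_eq_abs, abs_of_nonneg (mul_nonneg (exp_pos _).le (pow_nonneg (abs_nonneg _) 3)), Pi.add_apply]
    have e2' : g ξ ^ 2 = |g ξ| ^ 2 := (sq_abs _).symm
    have e4' : g ξ ^ 4 = |g ξ| ^ 4 := (Even.pow_abs ⟨2, rfl⟩ (g ξ)).symm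
    rw [e2', e4']
    set t := |g ξ|
    have ht : 0 ≤ t := abs_nonneg _
    have e0 := exp_pos (-U (matrixCLM A ξ + ψ))
    have h3 : t ^ 3 ≤ t ^ 2 + t ^ 4 := by nlinarith [sq_nonneg (t ^ 2 - t), sq_nonneg (t - 1), ht, pow_nonneg ht 2]
    calc exp (-U (matrixCLM A ξ + ψ)) * t ^ 3 ≤ exp (-U (matrixCLM A ξ + ψ)) * (t ^ 2 + t ^ 4) := mul_le_mul_of_nonneg_left h3 e0.le
      _ = exp (-U (matrixCLM A ξ + ψ)) * t ^ 2 + exp (-U (matrixCLM A ξ + ψ)) * t ^ 4 := by ring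
  -- `e·g³` is integrable (from `e·|g|³`)
  have k3' : Integrable (fun ξ : EuclideanSpace ℝ κ => exp (-U (matrixCLM A ξ + ψ)) * g ξ ^ 3)
      (multivariateGaussian 0 (1 : Matrix κ κ ℝ)) :=
    k3.mono' ((hEc.mul (hgc.pow 3)).aestronglyMeasurable) (ae_of_all _ fun ξ => by
      rw [Real.norm_eq_abs, abs_mul, abs_of_pos (exp_pos _), abs_pow])
  -- the centred observable `g₂ = (g − μ)²`
  have hg2 : ∀ ξ : EuclideanSpace ℝ κ, HasFDerivAt (fun ξ : EuclideanSpace ℝ κ => (g ξ - μ) ^ 2)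
      ((2 * (g ξ - μ)) •
        g' ξ) ξ := fun ξ => by
    have h := ((hgd ξ).sub_const μ).pow 2
    refine h.congr_fderiv ?_
    simp only [Nat.cast_ofNat, pow_one, Nat.add_one_sub_one, nsmul_eq_mul]
  have hg2'c : Continuous fun ξ : EuclideanSpace ℝ κ => (2 * (g ξ - μ)) •
      g' ξ := (continuous_const.mul (hgc.sub continuous_const)).smul hg'c
  -- its integrability letters
  have e2 : ∀ ξ : EuclideanSpace ℝ κ, exp (-U (matrixCLM A ξ + ψ)) * (g ξ - μ) ^ 2 =
      exp (-U (matrixCLM A ξ + ψ)) * g ξ ^ 2 -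
        2 * μ * (exp (-U (matrixCLM A ξ + ψ)) * g ξ) + μ ^ 2 * exp (-U (matrixCLM A ξ + ψ)) := fun ξ => by ring
  have ig2 : Integrable (fun ξ : EuclideanSpace ℝ κ => exp (-U (matrixCLM A ξ + ψ)) * (g ξ - μ) ^ 2)
      (multivariateGaussian 0 (1 : Matrix κ κ ℝ)) := by
    simp_rw [e2]; exact (k2.sub (k1.const_mul _)).add (hI.const_mul _)
  have e4 : ∀ ξ : EuclideanSpace ℝ κ, exp (-U (matrixCLM A ξ + ψ)) * ((g ξ - μ) ^ 2) ^ 2 =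
      exp (-U (matrixCLM A ξ + ψ)) * g ξ ^ 4 -
        4 * μ * (exp (-U (matrixCLM A ξ + ψ)) * g ξ ^ 3) +
        6 * μ ^ 2 * (exp (-U (matrixCLM A ξ + ψ)) * g ξ ^ 2) -
        4 * μ ^ 3 * (exp (-U (matrixCLM A ξ + ψ)) * g ξ) + μ ^ 4 * exp (-U (matrixCLM A ξ + ψ)) :=
    fun ξ => by ring
  have ig4 : Integrable (fun ξ : EuclideanSpace ℝ κ => exp (-U (matrixCLM A ξ + ψ)) * ((g ξ - μ) ^ 2) ^ 2)
      (multivariateGaussian 0 (1 : Matrix κ κ ℝ)) := by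
    simp_rw [e4]; exact ((((k4.sub (k3'.const_mul _)).add (k2.const_mul _)).sub (k1.const_mul _)).add (hI.const_mul _))
  have igD : Integrable (fun ξ : EuclideanSpace ℝ κ => exp (-U (matrixCLM A ξ + ψ)) * ‖(2 * (g ξ - μ)) •
      g' ξ‖ ^ 2) (multivariateGaussian 0 (1 : Matrix κ κ ℝ)) := by
    refine (ig2.const_mul (4 * L ^ 2)).mono' ((hEc.mul ((continuous_norm.comp hg2'c).pow 2)).aestronglyMeasurable)
      (ae_of_all _ fun ξ => ?_)
    rw [Real.norm_eq_abs, abs_of_nonneg (mul_nonneg (exp_pos _).le (sq_nonneg _)), norm_smul, mul_pow, Real.norm_eq_abs, abs_mul,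
      abs_two, mul_pow, sq_abs]
    have h1 : ‖g' ξ‖ ^ 2 ≤ L ^ 2 :=
      pow_le_pow_left₀ (norm_nonneg _) (hg'b ξ) 2
    nlinarith [exp_pos (-U (matrixCLM A ξ + ψ)), sq_nonneg (g ξ - μ),
      mul_nonneg (exp_pos (-U (matrixCLM A ξ + ψ))).le (sq_nonneg (g ξ - μ))]
  -- Poincaré for `g₂` in the `ξ`-coordinates ((422) with `M = I`)
  have hP := tilted_poincare (M := (1 : Matrix κ κ ℝ)) (m := 1) (lam := lam * γop) (U := fun η : EuclideanSpace ℝ κ => U (matrixCLM A η + ψ))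
    (U' := fun η : EuclideanSpace ℝ κ => (U' (matrixCLM A η + ψ)).comp (matrixCLM A)) Matrix.PosDef.one one_floor (whitened_hasFDerivAt hUd A ψ)
    (by positivity) (fun s hs0 hs1 a b => whitened_secant hΓop hlam hUsec ψ s hs0 hs1 a b) hρ (0 : EuclideanSpace ℝ κ)
    (by simpa only [add_zero, inv_one] using hI) hg2 hg2'c (by simpa only [add_zero, inv_one] using ig2) (by simpa only [add_zero, inv_one] using ig4)
    (by simpa only [add_zero, inv_one] using igD)
  simp only [add_zero, inv_one] at hP
  -- `E g₂ = Var(g) ≤ L²/(1−λγ_op)`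
  have hVar := obs_variance_le hΓop Y hUd hκ₀ hτ hθ1 hκθ hstab hlam hUsec hρ ψ hgd hg'c hg'b k1 k2
  have hEq : (∫ ξ : EuclideanSpace ℝ κ, exp (-U (matrixCLM A ξ + ψ)) ∂(multivariateGaussian 0 (1 : Matrix κ κ ℝ)))⁻¹ *
      (∫ ξ : EuclideanSpace ℝ κ, exp (-U (matrixCLM A ξ + ψ)) * (g ξ - μ) ^ 2
        ∂(multivariateGaussian 0 (1 : Matrix κ κ ℝ))) =
      (∫ ξ : EuclideanSpace ℝ κ, exp (-U (matrixCLM A ξ + ψ)) ∂(multivariateGaussian 0 (1 : Matrix κ κ ℝ)))⁻¹ *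
        (∫ ξ : EuclideanSpace ℝ κ, exp (-U (matrixCLM A ξ + ψ)) * g ξ ^ 2
          ∂(multivariateGaussian 0 (1 : Matrix κ κ ℝ))) - μ ^ 2 := by
    simp_rw [e2]
    have iB : Integrable (fun ξ : EuclideanSpace ℝ κ => exp (-U (matrixCLM A ξ + ψ)) * g ξ ^ 2 -
        2 * μ * (exp (-U (matrixCLM A ξ + ψ)) * g ξ)) (multivariateGaussian 0 (1 : Matrix κ κ ℝ)) :=
      k2.sub (k1.const_mul _)
    have iC : Integrable (fun ξ : EuclideanSpace ℝ κ => μ ^ 2 * exp (-U (matrixCLM A ξ + ψ))) (multivariateGaussian 0 (1 : Matrix κ κ ℝ)) :=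
        hI.const_mul _
    rw [integral_add iB iC, integral_sub k2 (k1.const_mul _), integral_const_mul, integral_const_mul]
    have hZne := hZ.ne'
    rw [hμ]
    field_simp
    ring
  have hEg2 : (∫ ξ : EuclideanSpace ℝ κ, exp (-U (matrixCLM A ξ + ψ)) ∂(multivariateGaussian 0 (1 : Matrix κ κ ℝ)))⁻¹ *
      (∫ ξ : EuclideanSpace ℝ κ, exp (-U (matrixCLM A ξ + ψ)) * (g ξ - μ) ^ 2
        ∂(multivariateGaussian 0 (1 : Matrix κ κ ℝ))) ≤ L ^ 2 / (1 - lam * γop) := by rw [hEq]; exact hVar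
  have hEg2nn : 0 ≤ (∫ ξ : EuclideanSpace ℝ κ, exp (-U (matrixCLM A ξ + ψ)) ∂(multivariateGaussian 0 (1 : Matrix κ κ ℝ)))⁻¹ *
      (∫ ξ : EuclideanSpace ℝ κ, exp (-U (matrixCLM A ξ + ψ)) * (g ξ - μ) ^ 2
        ∂(multivariateGaussian 0 (1 : Matrix κ κ ℝ))) :=
    mul_nonneg (inv_nonneg.2 hZ.le) (integral_nonneg fun ξ => mul_nonneg (exp_pos _).le (sq_nonneg _))
  -- the right side of Poincaré: `Z⁻¹∫e‖g₂′‖² ≤ 4L²·Z⁻¹∫e(g−μ)²`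
  have hR : (∫ ξ : EuclideanSpace ℝ κ, exp (-U (matrixCLM A ξ + ψ)) ∂(multivariateGaussian 0 (1 : Matrix κ κ ℝ)))⁻¹ *
      (∫ ξ : EuclideanSpace ℝ κ, exp (-U (matrixCLM A ξ + ψ)) * ‖(2 * (g ξ - μ)) •
        g' ξ‖ ^ 2 ∂(multivariateGaussian 0 (1 : Matrix κ κ ℝ))) ≤
      4 * L ^ 2 * ((∫ ξ : EuclideanSpace ℝ κ, exp (-U (matrixCLM A ξ + ψ)) ∂(multivariateGaussian 0 (1 : Matrix κ κ ℝ)))⁻¹ *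
        (∫ ξ : EuclideanSpace ℝ κ, exp (-U (matrixCLM A ξ + ψ)) * (g ξ - μ) ^ 2
          ∂(multivariateGaussian 0 (1 : Matrix κ κ ℝ)))) := by
    have h1 : (∫ ξ : EuclideanSpace ℝ κ, exp (-U (matrixCLM A ξ + ψ)) * ‖(2 * (g ξ - μ)) •
        g' ξ‖ ^ 2 ∂(multivariateGaussian 0 (1 : Matrix κ κ ℝ))) ≤
        ∫ ξ : EuclideanSpace ℝ κ, 4 * L ^ 2 * (exp (-U (matrixCLM A ξ + ψ)) * (g ξ - μ) ^ 2)
          ∂(multivariateGaussian 0 (1 : Matrix κ κ ℝ)) :=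
      integral_mono igD (ig2.const_mul _) fun ξ => by
        dsimp only
        rw [norm_smul, mul_pow, Real.norm_eq_abs, abs_mul, abs_two, mul_pow, sq_abs]
        have h1 : ‖g' ξ‖ ^ 2 ≤ L ^ 2 :=
          pow_le_pow_left₀ (norm_nonneg _) (hg'b ξ) 2
        nlinarith [exp_pos (-U (matrixCLM A ξ + ψ)), sq_nonneg (g ξ - μ),
          mul_nonneg (exp_pos (-U (matrixCLM A ξ + ψ))).le (sq_nonneg (g ξ - μ))]
    rw [integral_const_mul] at h1
    have := mul_le_mul_of_nonneg_left h1 (inv_nonneg.2 hZ.le)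
    linarith [this]
  -- assemble
  have epow : ∀ ξ : EuclideanSpace ℝ κ, exp (-U (matrixCLM A ξ + ψ)) * (g ξ - μ) ^ 4 =
      exp (-U (matrixCLM A ξ + ψ)) * ((g ξ - μ) ^ 2) ^ 2 := fun ξ => by ring
  simp_rw [epow]
  set E2 : ℝ := (∫ ξ : EuclideanSpace ℝ κ, exp (-U (matrixCLM A ξ + ψ)) ∂(multivariateGaussian 0 (1 : Matrix κ κ ℝ)))⁻¹ *
      (∫ ξ : EuclideanSpace ℝ κ, exp (-U (matrixCLM A ξ + ψ)) * (g ξ - μ) ^ 2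
        ∂(multivariateGaussian 0 (1 : Matrix κ κ ℝ))) with hE2
  set E4 : ℝ := (∫ ξ : EuclideanSpace ℝ κ, exp (-U (matrixCLM A ξ + ψ)) ∂(multivariateGaussian 0 (1 : Matrix κ κ ℝ)))⁻¹ *
      (∫ ξ : EuclideanSpace ℝ κ, exp (-U (matrixCLM A ξ + ψ)) * ((g ξ - μ) ^ 2) ^ 2
        ∂(multivariateGaussian 0 (1 : Matrix κ κ ℝ))) with hE4
  have hP' : E4 - E2 ^ 2 ≤ (1 - lam * γop)⁻¹ * (4 * L ^ 2 * E2) := hP.trans (mul_le_mul_of_nonneg_left hR (inv_nonneg.2 hρ0.le))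
  set d : ℝ := 1 - lam * γop
  have hb2 : E2 ≤ L ^ 2 / d := hEg2
  have hE2sq : E2 ^ 2 ≤ (L ^ 2 / d) ^ 2 := pow_le_pow_left₀ hEg2nn hb2 2
  have h4 : d⁻¹ * (4 * L ^ 2 * E2) ≤ 4 * L ^ 4 / d ^ 2 := by
    rw [show 4 * L ^ 4 / d ^ 2 = d⁻¹ * (4 * L ^ 2 * (L ^ 2 / d)) from by ring]
    exact mul_le_mul_of_nonneg_left (mul_le_mul_of_nonneg_left hb2 (by positivity)) (inv_nonneg.2 hρ0.le)
  have h5 : (L ^ 2 / d) ^ 2 = L ^ 4 / d ^ 2 := by ring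
  rw [h5] at hE2sq
  have : E4 ≤ 4 * L ^ 4 / d ^ 2 + L ^ 4 / d ^ 2 := by linarith
  calc E4 ≤ 4 * L ^ 4 / d ^ 2 + L ^ 4 / d ^ 2 := this
    _ = 5 * L ^ 4 / d ^ 2 := by ring

/-! ## §3. Toy -/

/-- Toy (the two Poincaré constants combine: `4 + 1 = 5`). -/
example (L d : ℝ) : 4 * L ^ 4 / d ^ 2 + L ^ 4 / d ^ 2 = 5 * L ^ 4 / d ^ 2 := by ring

end Summit.QuantumFields.BalabanUV.T4Continuum.NE7b.SupWhitenedObservableMoments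

end
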